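import Summits.NavierStokesRegularity.NavierStokesRegularity.Theorems.StrainDoorsViscous
import Literature.Analysis.FluidPDE.LeraySelfSimilarCalculus
import Literature.Analysis.FluidPDE.HyperbolicDSSOrbit
import HarnessLib

/-!
# StrainDoorsLerayRecord — the strain clock in similarity variables: the RECORD LAW of a Leray profile and the
# sharpness of the defect–lifespan law (door D12) on the self-similar class

nsreg-p1 g34, ROUND-51 (helper lane of `stmt-NavierStokesRegularity-0056`, rung N0; 0 ledger writes by the planner —
text for the S-lane to land `--supports stmt-NavierStokesRegularity-0056 --as helper`).

Let `(U, P)` be a smooth Leray profile (`Literature.Analysis.FluidPDE.IsLerayProfile ν a U P`: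
`−νΔU + aU + a(y·∇)U + (U·∇)U + ∇P = 0`, `div U = 0`, `a > 0`), i.e. `u = lerayBackward a T U`,
`p = lerayBackwardPressure a T P` is Leray's backward self-similar classical solution on `(−∞, T)`
(`lerayBackward_isClassical_iff_holds`).  Write `q_U(y,e) = ⟪∇U(y)e, e⟫` (strain form of the profile),
`H_U(y,e) = ¼(|curl U(y)|² − ⟪curl U(y), e⟫²) − ∇²P(y)(e,e)` (its feed) and `Δq_U` for the Laplacian of
`y ↦ q_U(y,e)`.

* §1 `lerayProfile_record_inequality` — **THE RECORD LAW OF A LERAY PROFILE**: at every critical point `y` of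
  `q_U(·,e)` (`|e| = 1`), `2a·q_U + q_U² − ν·Δq_U ≤ H_U` (an identity up to the eigenvector slack
  `|∇U e|_{sym}² ≥ q_U²` of plate E1_S⁺).  Proof: the lane's frame identity F_S (`strainFrame_holds`) and plate
  E1_S⁺ (`strainGrowthViscous_holds`) applied to Leray's backward field at the normalised time `t = 0`,
  `T = (2a)⁻¹` (where `λ = 1`, `u(0) = U`, `p(0) = P`), together with the computation of the one-sided time
  derivative of the strain form of the ansatz: `∂ₜ⟪∇u e,e⟫(0,y) = 2a·q_U(y,e) + a·(y·∇)q_U(y,e)`, whose second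
  term vanishes at a critical point.
* §2 `lerayProfile_record_inequality_of_isMax` — at a maximiser of `q_U(·,e)` over `y`: `2a·q_U + q_U² ≤ H_U`
  (`Δq_U ≤ 0` there, `inner_fderiv_laplacian_le_zero_of_isMax`); `lerayProfile_defect_law` — if moreover
  `q_U > 0` then `1 ≤ ((H_U − q_U²)/q_U²)·(q_U/(2a))`: the RECORD DEFECT times the profile strain number is ≥ 1.
* §3 `strainNumber_lerayBackward` — the dictionary: for `t < T`, `(T − t)·⟪∇u(t,x)e, e⟫ = (2a)⁻¹·q_U(λx, e)` for
  Leray's backward field — its strain number `(T − t)Λ(t)` is the constant `Λ_U/(2a)`.  Hence §2 is EXACTLY the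
  defect–lifespan law of door D12 (`defect_lifespan_law`, ROUND-50: blow-up ⇒ (record defect)·Λ(t₀)(T − t₀) ≥ 1,
  budget-free form) on the self-similar class, where it holds with equality up to the viscous term `ν|Δq_U|` and
  the eigenvector slack: D12's constant is SHARP on Leray profiles.

Dependencies: tree plates F_S `strainFrame_holds`, E1_S⁺ `strainGrowthViscous_holds`,
`inner_fderiv_laplacian_le_zero_of_isMax` / `inner_fderiv_laplacian_eq_laplacian_strain` (StrainDoorsGrowth /
StrainDoorsViscous); Literature `LeraySelfSimilarCalculus` (`lerayBackward_isClassical_iff_holds`,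
`fderiv_lerayBackward`, `hasDerivAt_lerayScale`, `lerayScale_sq`, `lerayBackward_apply_sub_inv`,
`lerayBackwardPressure_apply_sub_inv`).  No new definitions; no sorry.
-/

noncomputable section

open MeasureTheory Set Function Filter Metric Real InnerProductSpace
open _root_.Topology
open scoped ENNReal NNReal RealInnerProductSpace ContDiff Laplacian
open Literature.Analysis Literature.Analysis.FluidPDE
open Literature.Analysis.FluidPDE.VorticityDirectionDynamics

set_option linter.dupNamespace false

namespace Summit.NavierStokesRegularity.NavierStokesRegularity.Theorems.StrainDoors

open Summit.NavierStokesRegularity.NavierStokesRegularity.Theorems.ArgmaxDoors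

/-! ## §1 The record law of a Leray profile -/

/-- The one-sided time derivative, at the normalised time `t = 0` with `T = (2a)⁻¹`, of the strain form of Leray's
backward field along a fixed `(x, e)`: `∂ₜ(∇u e)(0,x) = D(y ↦ ∇U(y)e)(x)(a•x) + 2a•∇U(x)e`. [folklore] -/
theorem timeDerivWithin_fderiv_lerayBackward_zero {a : ℝ} (ha : 0 < a)
    {U : EuclideanSpace ℝ (Fin 3) → EuclideanSpace ℝ (Fin 3)} (hU : ContDiff ℝ ∞ U)
    (x e : EuclideanSpace ℝ (Fin 3)) :
    timeDerivWithin (Ico 0 (2 * a)⁻¹) (fun s y => fderiv ℝ (lerayBackward a (2 * a)⁻¹ U s) y e) 0 x =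
      fderiv ℝ (fun y => fderiv ℝ U y e) x (a • x) + (2 * a) • fderiv ℝ U x e := by
  have h2a : (2 * a) ≠ 0 := by positivity
  have hT : (0 : ℝ) < (2 * a)⁻¹ := by positivity
  -- the scale `L(s) = (2a(T − s))^{-1/2}`, `L(0) = 1`, `L'(0) = a`
  obtain ⟨L, hL⟩ : ∃ L : ℝ → ℝ, L = fun s => (Real.sqrt (2 * a * ((2 * a)⁻¹ - s)))⁻¹ := ⟨_, rfl⟩
  have harg : 2 * a * ((2 * a)⁻¹ - 0) = 1 := by rw [sub_zero, mul_inv_cancel₀ h2a]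
  have hL0 : L 0 = 1 := by
    rw [hL]
    show (Real.sqrt (2 * a * ((2 * a)⁻¹ - 0)))⁻¹ = 1
    rw [harg, Real.sqrt_one, inv_one]
  have hL' : HasDerivAt L a 0 := by
    have h := hasDerivAt_lerayScale (T := (2 * a)⁻¹) ha hT
    rw [← hL] at h
    refine h.congr_deriv ?_
    rw [harg, Real.sqrt_one, inv_one, one_pow, mul_one]
  have hL2 : HasDerivAt (fun s => L s ^ 2) (2 * a) 0 := by
    have hfun : (fun s => L s ^ 2) = fun s => L s * L s := funext fun s => sq (L s)
    rw [hfun]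
    refine (hL'.mul hL').congr_deriv ?_
    rw [hL0]
    ring
  have hpath : HasDerivAt (fun s => L s • x) (a • x) 0 := hL'.smul_const x
  -- `y ↦ ∇U(y) e` is differentiable
  have hU3 : ContDiff ℝ 3 U := hU.of_le (by norm_cast)
  have hD : ContDiff ℝ 2 (fun y => fderiv ℝ U y e) :=
    (hU3.fderiv_right (m := 2) (by norm_cast)).clm_apply contDiff_const
  have hDd : Differentiable ℝ (fun y => fderiv ℝ U y e) := hD.differentiable two_ne_zero
  have hx0 : L 0 • x = x := by rw [hL0, one_smul]
  have hcomp0 : HasDerivAt ((fun y => fderiv ℝ U y e) ∘ fun s => L s • x)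
      (fderiv ℝ (fun y => fderiv ℝ U y e) (L 0 • x) (a • x)) 0 :=
    (hDd (L 0 • x)).hasFDerivAt.comp_hasDerivAt (0 : ℝ) hpath
  have hcomp : HasDerivAt (fun s => fderiv ℝ U (L s • x) e)
      (fderiv ℝ (fun y => fderiv ℝ U y e) (L 0 • x) (a • x)) 0 := hcomp0
  rw [hx0] at hcomp
  have hG : HasDerivAt (fun s => L s ^ 2 • fderiv ℝ U (L s • x) e)
      (L 0 ^ 2 • fderiv ℝ (fun y => fderiv ℝ U y e) x (a • x) + (2 * a) • fderiv ℝ U (L 0 • x) e) 0 :=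
    hL2.smul hcomp
  rw [hx0, hL0, one_pow, one_smul] at hG
  -- the slices of the ansatz: `∇(u s)(x) e = L(s)² • ∇U(L(s) x) e`
  have hGeq : (fun s => fderiv ℝ (lerayBackward a (2 * a)⁻¹ U s) x e) =
      fun s => L s ^ 2 • fderiv ℝ U (L s • x) e := by
    funext s
    rw [fderiv_lerayBackward, hL]
    rfl
  rw [timeDerivWithin_apply]
  change derivWithin (fun s => fderiv ℝ (lerayBackward a (2 * a)⁻¹ U s) x e) (Ico 0 (2 * a)⁻¹) 0 = _
  rw [hGeq]
  exact hG.hasDerivWithinAt.derivWithin (uniqueDiffOn_Ico 0 (2 * a)⁻¹ 0 ⟨le_rfl, hT⟩)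

/-- ★ **THE RECORD LAW OF A LERAY PROFILE.**  For a smooth Leray profile `(U,P)` with `ν > 0`, `a > 0`, at every
critical point `x` of `y ↦ ⟪∇U(y)e, e⟫` (`|e| = 1`):
`2a·⟪∇U e,e⟫ + ⟪∇U e,e⟫² − ν·Δ(y ↦ ⟪∇U(y)e,e⟫)(x) ≤ ¼(|curl U|² − ⟪curl U, e⟫²) − ∇²P(e,e)` — the strain clock
`∂ₜq ≤ −q² + H + νΔq` of the lane read in similarity variables, where `∂ₜq` becomes `2a·q` at a record.
[folklore: Leray's reduction + plate E1_S⁺; the profile form of CIB20 §2.1 / BPB22 (15)] -/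
theorem lerayProfile_record_inequality {ν a : ℝ}
    {U : EuclideanSpace ℝ (Fin 3) → EuclideanSpace ℝ (Fin 3)} {P : EuclideanSpace ℝ (Fin 3) → ℝ}
    (hν : 0 < ν) (ha : 0 < a) (hU : ContDiff ℝ ∞ U) (hP : ContDiff ℝ ∞ P) (hprof : IsLerayProfile ν a U P)
    {x e : EuclideanSpace ℝ (Fin 3)} (he : ‖e‖ = 1)
    (hcrit : fderiv ℝ (fun y => ⟪fderiv ℝ U y e, e⟫) x = 0) :
    2 * a * ⟪fderiv ℝ U x e, e⟫ + ⟪fderiv ℝ U x e, e⟫ ^ 2 - ν * (Δ (fun y => ⟪fderiv ℝ U y e, e⟫)) x ≤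
      (1 / 4) * (‖curl U x‖ ^ 2 - ⟪curl U x, e⟫ ^ 2) - ⟪fderiv ℝ (gradient P) x e, e⟫ := by
  have h2a : (2 * a) ≠ 0 := by positivity
  have hT : (0 : ℝ) < (2 * a)⁻¹ := by positivity
  obtain ⟨T, hTdef⟩ : ∃ T : ℝ, T = (2 * a)⁻¹ := ⟨_, rfl⟩
  obtain ⟨u, hu⟩ : ∃ u : ℝ → EuclideanSpace ℝ (Fin 3) → EuclideanSpace ℝ (Fin 3), u = lerayBackward a T U :=
    ⟨_, rfl⟩
  obtain ⟨p, hp⟩ : ∃ p : ℝ → EuclideanSpace ℝ (Fin 3) → ℝ, p = lerayBackwardPressure a T P := ⟨_, rfl⟩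
  -- Leray's reduction: the backward field is a classical solution below `T`
  have hsolI : IsClassicalNSSolutionOn (Iio T) ν 0 u p := by
    rw [hu, hp]
    exact (lerayBackward_isClassical_iff_holds ha hU hP).2 hprof
  have hT' : 0 < T := by rw [hTdef]; exact hT
  have hsol : IsClassicalNSSolutionOn (Ico 0 T) ν 0 u p :=
    hsolI.mono Ico_subset_Iio_self (uniqueDiffOn_Ico 0 T)
  have h0T : (0 : ℝ) ∈ Ico 0 T := ⟨le_rfl, hT'⟩
  -- at the normalised time the slices are the profiles themselves
  have h0 : (0 : ℝ) = T - (2 * a)⁻¹ := by rw [hTdef, sub_self]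
  have hu0 : u 0 = U := by rw [hu, h0]; exact lerayBackward_apply_sub_inv ha T U
  have hp0 : p 0 = P := by rw [hp, h0]; exact lerayBackwardPressure_apply_sub_inv ha T P
  -- frame identity F_S at `t = 0` and plate E1_S⁺
  have hframe := strainFrame_holds ν T hν hT' u p hsol 0 h0T x e
  rw [hu0, hp0] at hframe
  have hE := strainGrowthViscous_holds ν U P hU x e he hcrit _ hframe
  -- the time derivative of the strain form of the ansatz at a critical point is `2a·q`
  have hw : timeDerivWithin (Ico 0 T) (fun s y => fderiv ℝ (u s) y e) 0 x =
      fderiv ℝ (fun y => fderiv ℝ U y e) x (a • x) + (2 * a) • fderiv ℝ U x e := by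
    rw [hu, hTdef]
    exact timeDerivWithin_fderiv_lerayBackward_zero ha hU x e
  have hU3 : ContDiff ℝ 3 U := hU.of_le (by norm_cast)
  have hD : ContDiff ℝ 2 (fun y => fderiv ℝ U y e) :=
    (hU3.fderiv_right (m := 2) (by norm_cast)).clm_apply contDiff_const
  have hDd : Differentiable ℝ (fun y => fderiv ℝ U y e) := hD.differentiable two_ne_zero
  have hDe : ⟪fderiv ℝ (fun y => fderiv ℝ U y e) x (a • x), e⟫ = 0 := by
    have h1 := fderiv_inner_apply ℝ (hDd x) (differentiableAt_const e) (a • x)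
    have h2 : fderiv ℝ (fun y => ⟪fderiv ℝ U y e, e⟫) x (a • x) = 0 := by rw [hcrit]; rfl
    rw [h2, fderiv_fun_const, Pi.zero_apply, zero_apply, inner_zero_right, zero_add] at h1
    exact h1.symm
  have hwe : ⟪timeDerivWithin (Ico 0 T) (fun s y => fderiv ℝ (u s) y e) 0 x, e⟫ = 2 * a * ⟪fderiv ℝ U x e, e⟫ := by
    rw [hw, inner_add_left, real_inner_smul_left, hDe, zero_add]
  rw [hwe] at hE
  linarith

/-! ## §2 At a maximiser: the defect law of a profile -/

/-- At a maximiser `x` of `y ↦ ⟪∇U(y)e, e⟫` (`|e| = 1`) of a smooth Leray profile: `2a·q_U + q_U² ≤ H_U` — the feed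
exceeds parity by at least `2a·q_U` (`Δq_U ≤ 0` at the maximum and `ν > 0`). [folklore] -/
theorem lerayProfile_record_inequality_of_isMax {ν a : ℝ}
    {U : EuclideanSpace ℝ (Fin 3) → EuclideanSpace ℝ (Fin 3)} {P : EuclideanSpace ℝ (Fin 3) → ℝ}
    (hν : 0 < ν) (ha : 0 < a) (hU : ContDiff ℝ ∞ U) (hP : ContDiff ℝ ∞ P) (hprof : IsLerayProfile ν a U P)
    {x e : EuclideanSpace ℝ (Fin 3)} (he : ‖e‖ = 1)
    (hmax : ∀ y, ⟪fderiv ℝ U y e, e⟫ ≤ ⟪fderiv ℝ U x e, e⟫) :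
    2 * a * ⟪fderiv ℝ U x e, e⟫ + ⟪fderiv ℝ U x e, e⟫ ^ 2 ≤
      (1 / 4) * (‖curl U x‖ ^ 2 - ⟪curl U x, e⟫ ^ 2) - ⟪fderiv ℝ (gradient P) x e, e⟫ := by
  have hloc : IsLocalMax (fun y => ⟪fderiv ℝ U y e, e⟫) x := Filter.Eventually.of_forall fun y => hmax y
  have hcrit : fderiv ℝ (fun y => ⟪fderiv ℝ U y e, e⟫) x = 0 := hloc.fderiv_eq_zero
  have h := lerayProfile_record_inequality hν ha hU hP hprof he hcrit
  have h1 := inner_fderiv_laplacian_le_zero_of_isMax hU x e hmax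
  rw [inner_fderiv_laplacian_eq_laplacian_strain hU x e] at h1
  have h3 : ν * (Δ (fun y => ⟪fderiv ℝ U y e, e⟫)) x ≤ 0 := mul_nonpos_of_nonneg_of_nonpos hν.le h1
  linarith

/-- ★ **THE DEFECT LAW OF A LERAY PROFILE** (= door D12's defect–lifespan law on the self-similar class, SHARP).
At a maximiser `x` of `y ↦ ⟪∇U(y)e,e⟫` with `q_U := ⟪∇U(x)e,e⟫ > 0`: the record defect `(H_U − q_U²)/q_U²` times the
profile strain number `q_U/(2a)` is at least `1`.  For Leray's backward field the strain number `(T − t)⟪∇u(t)e,e⟫`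
IS `q_U/(2a)` (`strainNumber_lerayBackward`), so this is `defect_lifespan_law` (ROUND-50) in its budget-free limit
form, attained up to the viscous term and the eigenvector slack. [folklore] -/
theorem lerayProfile_defect_law {ν a : ℝ}
    {U : EuclideanSpace ℝ (Fin 3) → EuclideanSpace ℝ (Fin 3)} {P : EuclideanSpace ℝ (Fin 3) → ℝ}
    (hν : 0 < ν) (ha : 0 < a) (hU : ContDiff ℝ ∞ U) (hP : ContDiff ℝ ∞ P) (hprof : IsLerayProfile ν a U P)
    {x e : EuclideanSpace ℝ (Fin 3)} (he : ‖e‖ = 1)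
    (hmax : ∀ y, ⟪fderiv ℝ U y e, e⟫ ≤ ⟪fderiv ℝ U x e, e⟫) (hq : 0 < ⟪fderiv ℝ U x e, e⟫) :
    1 ≤ ((1 / 4) * (‖curl U x‖ ^ 2 - ⟪curl U x, e⟫ ^ 2) - ⟪fderiv ℝ (gradient P) x e, e⟫ -
        ⟪fderiv ℝ U x e, e⟫ ^ 2) / ⟪fderiv ℝ U x e, e⟫ ^ 2 * (⟪fderiv ℝ U x e, e⟫ / (2 * a)) := by
  have h := lerayProfile_record_inequality_of_isMax hν ha hU hP hprof he hmax
  obtain ⟨q, hqdef⟩ : ∃ q : ℝ, q = ⟪fderiv ℝ U x e, e⟫ := ⟨_, rfl⟩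
  obtain ⟨H, hHdef⟩ : ∃ H : ℝ,
      H = (1 / 4) * (‖curl U x‖ ^ 2 - ⟪curl U x, e⟫ ^ 2) - ⟪fderiv ℝ (gradient P) x e, e⟫ := ⟨_, rfl⟩
  rw [← hqdef, ← hHdef] at h ⊢
  rw [← hqdef] at hq
  have h2a : 0 < 2 * a := by positivity
  have hkey : 2 * a * q ≤ H - q ^ 2 := by linarith
  have heq : (H - q ^ 2) / q ^ 2 * (q / (2 * a)) = (H - q ^ 2) / (2 * a * q) := by
    rw [div_mul_div_comm, pow_two, mul_assoc q q (2 * a), mul_comm (H - q * q) q, mul_div_mul_left _ _ hq.ne',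
      mul_comm q (2 * a)]
  rw [heq]
  have hden : 0 < 2 * a * q := by positivity
  calc (1 : ℝ) = (2 * a * q) / (2 * a * q) := (div_self hden.ne').symm
    _ ≤ (H - q ^ 2) / (2 * a * q) := div_le_div_of_nonneg_right hkey hden.le

/-! ## §3 The dictionary: the strain number of Leray's backward field -/

/-- For Leray's backward field `u = lerayBackward a T U` and `t < T`:
`(T − t)·⟪∇u(t,x)e, e⟫ = (2a)⁻¹·⟪∇U(λx)e, e⟫`, `λ = (2a(T−t))^{-1/2}` — the strain number `(T − t)Λ(t)` of a
self-similar blow-up is the constant `Λ_U/(2a)`. [folklore] -/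
theorem strainNumber_lerayBackward {a T t : ℝ} (ha : 0 < a) (ht : t < T)
    (U : EuclideanSpace ℝ (Fin 3) → EuclideanSpace ℝ (Fin 3)) (x e : EuclideanSpace ℝ (Fin 3)) :
    (T - t) * ⟪fderiv ℝ (lerayBackward a T U t) x e, e⟫ =
      (2 * a)⁻¹ * ⟪fderiv ℝ U ((Real.sqrt (2 * a * (T - t)))⁻¹ • x) e, e⟫ := by
  rw [fderiv_lerayBackward, _root_.smul_apply, real_inner_smul_left, lerayScale_sq ha ht, ← mul_assoc]
  have hTt : T - t ≠ 0 := (sub_pos.2 ht).ne'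
  have h2a : (2 * a) ≠ 0 := by positivity
  have hc : (T - t) * (2 * a * (T - t))⁻¹ = (2 * a)⁻¹ := by
    rw [mul_inv, ← mul_assoc, mul_comm (T - t), mul_assoc, mul_inv_cancel₀ hTt, mul_one]
  rw [hc]

/-- The same in the lane's notation: `(T − t)·strainQuad u t x e = (2a)⁻¹·q_U(λx, e)` for `u = lerayBackward a T U`. -/
theorem strainNumber_lerayBackward' {a T t : ℝ} (ha : 0 < a) (ht : t < T)
    (U : EuclideanSpace ℝ (Fin 3) → EuclideanSpace ℝ (Fin 3)) (x e : EuclideanSpace ℝ (Fin 3)) :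
    (T - t) * strainQuad (lerayBackward a T U) t x e =
      (2 * a)⁻¹ * ⟪fderiv ℝ U ((Real.sqrt (2 * a * (T - t)))⁻¹ • x) e, e⟫ := by
  unfold strainQuad
  exact strainNumber_lerayBackward ha ht U x e


/-! ## §4 Discretely self-similar blow-up: the strain number IS the similarity strain, and the periodic clock law -/

/-- The dictionary for the backward similarity orbit (`Literature … lerayOrbit`, blow-up at the space–time origin,
`U(s,y) = e^{−s/2} u(−e^{−s}, e^{−s/2}y)`): `⟪∇U(s,y)e, e⟫ = e^{−s}·⟪∇u(t,x)e, e⟫ = (0 − t)·⟪∇u(t,x)e,e⟫` with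
`t = −e^{−s}`, `x = e^{−s/2}y` — the similarity strain form IS the lane's strain number `(T − t)·strainQuad`.
[folklore] -/
theorem strain_lerayOrbit (u : ℝ → EuclideanSpace ℝ (Fin 3) → EuclideanSpace ℝ (Fin 3)) (s : ℝ)
    (y e : EuclideanSpace ℝ (Fin 3)) :
    ⟪fderiv ℝ (lerayOrbit u s) y e, e⟫ =
      Real.exp (-s) * ⟪fderiv ℝ (u (-Real.exp (-s))) (Real.exp (-s / 2) • y) e, e⟫ := by
  have hfun : lerayOrbit u s = fun z => Real.exp (-s / 2) • u (-Real.exp (-s)) (Real.exp (-s / 2) • z) := by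
    funext z
    rfl
  rw [hfun, fderiv_smul_comp_smul, _root_.smul_apply, real_inner_smul_left, sq, ← Real.exp_add]
  congr 1
  ring_nf

/-- The same in the lane's notation, blow-up time `T = 0`, `t = −e^{−s} < 0`, `x = e^{−s/2}•y`:
`(0 − t)·strainQuad u t x e = ⟪∇U(s,y)e, e⟫` — the strain NUMBER of the lane is the similarity strain form. [folklore] -/
theorem strainNumber_eq_strain_lerayOrbit (u : ℝ → EuclideanSpace ℝ (Fin 3) → EuclideanSpace ℝ (Fin 3)) (s : ℝ)
    (y e : EuclideanSpace ℝ (Fin 3)) :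
    (0 - (-Real.exp (-s))) * strainQuad u (-Real.exp (-s)) (Real.exp (-s / 2) • y) e =
      ⟪fderiv ℝ (lerayOrbit u s) y e, e⟫ := by
  rw [strain_lerayOrbit, sub_neg_eq_add, zero_add]
  rfl

/-- ★ **THE PERIODIC CLOCK LAW** (abstract form of the defect–lifespan law for discretely self-similar blow-up).
Let `M : ℝ → ℝ` be continuous, positive and `L`-periodic (`L > 0`) — the similarity strain number of a DSS
blow-up along its `2 log λ`-periodic orbit — and obey the similarity-variable strain clock
`D⁺M(τ) ≤ M(τ)·((c(τ) − 1)·M(τ) − 1)` (the lane's clock `∂ₜq ≤ −q² + c·q²` at records, rewritten for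
`N = (T − t)q` in `τ = −log(T − t)`; `c(τ)` = the record feed ratio at phase `τ`).  Then at a period-minimum `τ₀`
of `M`: `(c(τ₀) − 1)·M(τ₀) ≥ 1`.  Leray profiles are the constant case (§2). [folklore] -/
theorem periodicClock_min_law {M c : ℝ → ℝ} {L : ℝ} (hL : 0 < L) (hper : Function.Periodic M L)
    (hcont : Continuous M) (hpos : ∀ τ, 0 < M τ)
    (hclock : ∀ τ r, M τ * ((c τ - 1) * M τ - 1) < r → ∀ᶠ h in 𝓝[>] (0 : ℝ), M (τ + h) - M τ ≤ r * h) :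
    ∃ τ₀, (∀ τ, M τ₀ ≤ M τ) ∧ 1 ≤ (c τ₀ - 1) * M τ₀ := by
  obtain ⟨τ₀, _, hmin⟩ :=
    isCompact_Icc.exists_isMinOn (nonempty_Icc.2 hL.le) (hcont.continuousOn (s := Icc 0 L))
  have hglob : ∀ τ, M τ₀ ≤ M τ := by
    intro τ
    obtain ⟨y, hy, hMy⟩ := hper.exists_mem_Ico₀ hL τ
    rw [hMy]
    exact hmin (Ico_subset_Icc_self hy)
  refine ⟨τ₀, hglob, ?_⟩
  by_contra hlt
  push Not at hlt
  have hneg : M τ₀ * ((c τ₀ - 1) * M τ₀ - 1) < 0 :=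
    mul_neg_of_pos_of_neg (hpos τ₀) (by linarith)
  obtain ⟨r, hr⟩ : ∃ r : ℝ, r = M τ₀ * ((c τ₀ - 1) * M τ₀ - 1) / 2 := ⟨_, rfl⟩
  have hr_lt : M τ₀ * ((c τ₀ - 1) * M τ₀ - 1) < r := by rw [hr]; linarith
  have hr_neg : r < 0 := by rw [hr]; linarith
  have hev := hclock τ₀ r hr_lt
  obtain ⟨h, hMh, hh⟩ := (hev.and self_mem_nhdsWithin).exists
  have hh' : 0 < h := hh
  have h1 : M (τ₀ + h) < M τ₀ := by nlinarith
  exact absurd (hglob (τ₀ + h)) (not_le.2 h1)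

/-- **THE PHASE LAW.**  Under the hypotheses of `periodicClock_min_law` there is a phase `τ₀` whose record defect
controls the strain number at EVERY phase: `(c(τ₀) − 1)·M(τ) ≥ 1` for all `τ` — a discretely self-similar
blow-up must, once per period, produce a strain-record defect at least the reciprocal of its largest strain number.
[folklore] -/
theorem periodicClock_phase_law {M c : ℝ → ℝ} {L : ℝ} (hL : 0 < L) (hper : Function.Periodic M L)
    (hcont : Continuous M) (hpos : ∀ τ, 0 < M τ)
    (hclock : ∀ τ r, M τ * ((c τ - 1) * M τ - 1) < r → ∀ᶠ h in 𝓝[>] (0 : ℝ), M (τ + h) - M τ ≤ r * h) :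
    ∃ τ₀, ∀ τ, 1 ≤ (c τ₀ - 1) * M τ := by
  obtain ⟨τ₀, hglob, hlaw⟩ := periodicClock_min_law hL hper hcont hpos hclock
  refine ⟨τ₀, fun τ => ?_⟩
  have hc : 0 ≤ c τ₀ - 1 := by
    by_contra hc
    push Not at hc
    have : (c τ₀ - 1) * M τ₀ < 0 := mul_neg_of_neg_of_pos hc (hpos τ₀)
    linarith
  calc (1 : ℝ) ≤ (c τ₀ - 1) * M τ₀ := hlaw
    _ ≤ (c τ₀ - 1) * M τ := mul_le_mul_of_nonneg_left (hglob τ) hc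

end Summit.NavierStokesRegularity.NavierStokesRegularity.Theorems.StrainDoors
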